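import Summits.ResolutionOfSingularities.ResolutionOfSingularities.Theorems.PurelyInseparableDim4WinCertSound
import Summits.ResolutionOfSingularities.ResolutionOfSingularities.Theorems.PurelyInseparableDim4ScopeBlindRational
import Summits.ResolutionOfSingularities.ResolutionOfSingularities.Theorems.PurelyInseparableDim4FrameTraps
import HarnessLib
import HarnessLib.Audit.Tags

/-!
# Purely inseparable fourfolds — IN-SCOPE (F4-C) WIN CERTIFICATES over a finite field
# [OURS · counted 0 · a certificate format for OUR frame v4, not about resolution]

Census cell «res-dim4-pi» (D-0157 DOOR 2), width seat `res-dim4-p-14`, brick PR-12u; sequel of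
`PurelyInseparableDim4WinCertSound` (PR-12t, full game) for the F4-C game of the Scope add-on
(`TerminatesInScope`; game form `FrameTraps.terminatesInScope_iff_forall_wins`: player A moves — a
permissible coordinate centre — only at IN-SCOPE states; an OUT-OF-SCOPE state is terminal and WON for A).

* `InScopeStateWins q s` — A's attractor of the in-scope game (the F4-C analogue of `StateWins`);
  `wins_restrict` (restricting A's legal moves by a predicate on positions keeps every win, since a position
  failing the predicate becomes terminal) ⇒ `inScopeStateWins_of_stateWins` (ESCAPABLE ⇒ in-scope escapable),
  `inScopeStateWins_of_not_inCoordinateScope` (BLIND ⇒ won), `terminatesInScope_iff_forall_inScopeStateWins`;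
* the certificate FORMAT over a FINITE field (`[Fintype K]`): rows «(presented state, A's centre, optional
  BLINDNESS certificate)», children later in the list; a row is discharged by (i) a blindness certificate of
  its own state — res-dim4-p-13's `decide`-able `ScopeBlind.blindB` (monomial curve) / `ScopeBlind.rblindB`
  (rational curve), packaged as `BlindCert` with `BlindCert.check` / `not_inCoordinateScope_of_check` — or
  (ii) a non-`q`-fold origin, or (iii) a permissible centre all of whose `K`-rational replies are not
  equimultiple / kill `F` / are certified later (`iwinCertB`);
* **`inScopeStateWins_of_iwinCertB`** — soundness: every row of a checked certificate is in A's in-scope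
  attractor over `K`; `iwinCertB_map_of_winCertB` — a full-game certificate is an in-scope certificate;
* ACCEPTANCE by `decide` over `𝔽₂`: res-dim4-p-6's SCOPE-LOSS parent `x₁³(x₂ + x₃x₄)` (`…ScopeLoss`: in scope,
  forced divisor `{x₁}`, child at the chart origin BLIND) is IN-SCOPE-ESCAPABLE in ONE move — of the 8
  `𝔽₂`-replies to the divisor, 4 are not equimultiple and the 4 equimultiple ones
  `x₁(x₂ + βx₃ + γx₄ + x₃x₄)` are BLIND-REGULAR, each by a monomial-curve certificate
  (`iwinCertB_scopeLoss`, `inScopeStateWins_scopeLoss`).  Reading: p-6's scope loss is, in the F4-C game, an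
  immediate WIN for A (B has left the scope).

CAVEAT: `K`-rational replies only (`[Fintype K]`); in-scope escapability over `𝔽₂` does not ascend to
`𝔽₄` (PR-12k descends only).  Nothing here proves resolution of singularities in dimension ≥ 4 /
characteristic `p`; counted 0; AI work, weaker than expert review.
bears_on: LADDER-RESOLUTION:D157-DOOR2 (res-dim4-pi · PR-12u · F4-C instrument). Supports
stmt-ResolutionOfSingularities-16155 (helper).
-/

set_option linter.dupNamespace false

noncomputable section

namespace Summit.ResolutionOfSingularities.ResolutionOfSingularities.Theorems.PIDim4

namespace InScopeWinCert

open Literature.AlgebraicGeometry.Resolution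
open StepKit WinCertSound ScopeBlind

/-! ## 1. The in-scope attractor -/

/-- **Restricting A's legal moves by a predicate on positions keeps every win**: at a position failing
the predicate no move is legal any more, so the position is terminal (won). [folklore] -/
theorem wins_restrict {P M : Type} {legal : P → M → Prop} {succ : P → M → P → Prop} (Q : P → Prop)
    {x : P} (hx : Game.Wins legal succ x) : Game.Wins (fun x m => Q x ∧ legal x m) succ x := by
  induction hx with
  | terminal h => exact Game.Wins.terminal fun m hm => h m hm.2
  | @move x m hm _ ih =>
    by_cases hQ : Q x
    · exact Game.Wins.move (m := m) ⟨hQ, hm⟩ fun y hy => ih y hy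
    · exact Game.Wins.terminal fun m' hm' => hQ hm'.1

variable {K : Type} [Field K] [DecidableEq K]

/-- **In-scope escapable state**: A's attractor of the F4-C game — A moves (a permissible coordinate
centre) only at IN-SCOPE states, every edge must lead to an in-scope escapable state; an out-of-scope or
non-`q`-fold state is terminal, i.e. won. [folklore] -/
def InScopeStateWins (q : ℕ) (s : State K) : Prop :=
  Game.Wins (fun (t : State K) (S : Finset (Fin 4)) => InCoordinateScope q t.F ∧ IsPermissibleCentre q S t.F)
    (fun t S t' => Edge q S t t') s

/-- ESCAPABLE ⇒ in-scope escapable. [folklore] -/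
theorem inScopeStateWins_of_stateWins {q : ℕ} {s : State K} (h : StateWins q s) :
    InScopeStateWins q s :=
  wins_restrict (fun t : State K => InCoordinateScope q t.F) h

/-- A BLIND (out-of-scope) state is won at once. [folklore] -/
theorem inScopeStateWins_of_not_inCoordinateScope {q : ℕ} {s : State K}
    (h : ¬ InCoordinateScope q s.F) : InScopeStateWins q s :=
  Game.Wins.terminal fun _ hS => h hS.1

/-- A state with no permissible centre is won at once. [folklore] -/
theorem inScopeStateWins_of_no_permissible {q : ℕ} {s : State K}
    (h : ∀ S, ¬ IsPermissibleCentre q S s.F) : InScopeStateWins q s :=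
  Game.Wins.terminal fun S hS => h S hS.2

/-- A move at an in-scope-or-not state: a permissible centre all of whose edges lead to in-scope
escapable states wins (if the state is out of scope it is won anyway). [folklore] -/
theorem inScopeStateWins_move {q : ℕ} {s : State K} (S : Finset (Fin 4))
    (hS : IsPermissibleCentre q S s.F) (h : ∀ s', Edge q S s s' → InScopeStateWins q s') :
    InScopeStateWins q s := by
  by_cases hsc : InCoordinateScope q s.F
  · exact Game.Wins.move (m := S) ⟨hsc, hS⟩ h
  · exact inScopeStateWins_of_not_inCoordinateScope hsc

/-- **F4-C ⟺ every state over every field of characteristic `p` is in-scope escapable**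
(`FrameTraps.terminatesInScope_iff_forall_wins`, renamed). [folklore] -/
theorem terminatesInScope_iff_forall_inScopeStateWins (p q : ℕ) :
    TerminatesInScope p q ↔
      ∀ (K : Type) [Field K] [CharP K p] [DecidableEq K], ∀ s : State K, InScopeStateWins q s :=
  FrameTraps.terminatesInScope_iff_forall_wins p q

/-! ## 2. Blindness certificates (res-dim4-p-13's checkers, packaged) -/

/-- A BLINDNESS certificate for a presented state: a monomial curve (`ScopeBlind.blindB`) or a rational
curve (`ScopeBlind.rblindB`) inside `V(J_q⁺)` through the origin, with a witness point. [folklore] -/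
inductive BlindCert (K : Type) : Type
  /-- monomial curve `xᵢ = cᵢ t^{wᵢ}`, witness derivative `α₀` at the point `a` -/
  | mono (c : Fin 4 → K) (w : Fin 4 → ℕ) (α₀ : Fin 4 → ℕ) (a : Fin 4 → K) : BlindCert K
  /-- rational curve `xᵢ = Pᵢ(t) / D(t)^{vᵢ}`, hull exponents `k`, witness `α₀` at `a` -/
  | rat (P : Fin 4 → Terms 1 K) (v : Fin 4 → ℕ) (D : Terms 1 K) (k : Fin 4 → ℕ) (α₀ : Fin 4 → ℕ)
      (a : Fin 4 → K) : BlindCert K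

/-- Running the packaged checker. [folklore] -/
def BlindCert.check (q : ℕ) (s : SData 4 K) : BlindCert K → Bool
  | .mono c w α₀ a => blindB q s c w α₀ a
  | .rat P v D k α₀ a => rblindB q s P v D k α₀ a

/-- **Soundness of the packaged blindness check.** [folklore] -/
theorem not_inCoordinateScope_of_check {q : ℕ} {s : SData 4 K} :
    ∀ {β : BlindCert K}, β.check q s = true → ¬ InCoordinateScope q s.toState.F
  | .mono _ _ _ _, h => not_inCoordinateScope_of_blindB h
  | .rat _ _ _ _ _ _, h => not_inCoordinateScope_of_rblindB h

/-! ## 3. The certificate format and its checker -/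

/-- An in-scope certificate row: presented state, A's centre, optional blindness certificate. [folklore] -/
abbrev IRow (K : Type) : Type := SData 4 K × Finset (Fin 4) × Option (BlindCert K)

/-- An in-scope win certificate (children LATER in the list). [folklore] -/
abbrev ICert (K : Type) : Type := List (IRow K)

variable [Fintype K]

/-- The child `c` occurs among the states of `rest`. [folklore] -/
def ichildIn (rest : ICert K) (c : SData 4 K) : Bool :=
  rest.any fun r => c.equivB r.1

/-- B's reply `(j, b)` is harmless: not equimultiple, or kills `F`, or certified later. [folklore] -/
def ireplyOK (q : ℕ) (rest : ICert K) (s : SData 4 K) (S : Finset (Fin 4)) (j : Fin 4)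
    (b : Fin 4 → K) : Bool :=
  !(equiB q S j b s) || StepKit.equivB (stepD q S j b s).L [] || ichildIn rest (stepD q S j b s)

/-- The row carries a passing blindness certificate. [folklore] -/
def blindOK (q : ℕ) (row : IRow K) : Bool :=
  match row.2.2 with
  | none => false
  | some β => β.check q row.1

/-- The row check: BLIND, or TERMINAL (origin not `q`-fold), or a permissible centre all of whose
`K`-rational replies are harmless. [folklore] -/
def irowOK (q : ℕ) (rest : ICert K) (row : IRow K) : Bool :=
  blindOK q row || !(permB q Finset.univ row.1.L) ||
    (permB q row.2.1 row.1.L &&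
      decide (∀ j ∈ row.2.1, ∀ b : Fin 4 → K, b j = 0 → ireplyOK q rest row.1 row.2.1 j b = true))

/-- **The in-scope win-certificate checker.** [folklore] -/
def iwinCertB (q : ℕ) : ICert K → Bool
  | [] => true
  | row :: rest => irowOK q rest row && iwinCertB q rest

omit [Fintype K] in
/-- Soundness of `ichildIn`. [folklore] -/
theorem exists_of_ichildIn [Fintype K] {rest : ICert K} {c : SData 4 K} (h : ichildIn rest c = true) :
    ∃ r ∈ rest, c.toState = r.1.toState := by
  unfold ichildIn at h
  obtain ⟨r, hr, hrc⟩ := List.any_eq_true.mp h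
  exact ⟨r, hr, (toState_eq_iff c r.1).mpr hrc⟩

/-- **SOUNDNESS of one row.** [folklore] -/
theorem inScopeStateWins_of_irowOK {q : ℕ} {rest : ICert K}
    (hrest : ∀ r ∈ rest, InScopeStateWins q r.1.toState) {row : IRow K}
    (h : irowOK q rest row = true) : InScopeStateWins q row.1.toState := by
  unfold irowOK at h
  rw [Bool.or_eq_true, Bool.or_eq_true] at h
  rcases h with (hblind | hterm) | hmove
  · -- a blindness certificate
    unfold blindOK at hblind
    obtain ⟨s, S, oβ⟩ := row
    cases oβ with
    | none => exact absurd hblind Bool.false_ne_true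
    | some β => exact inScopeStateWins_of_not_inCoordinateScope (not_inCoordinateScope_of_check hblind)
  · -- terminal: no permissible centre
    have hperm : permB q Finset.univ row.1.L = false := by
      rw [Bool.not_eq_true'] at hterm; exact hterm
    exact inScopeStateWins_of_no_permissible (no_permissible_of_not_permB hperm)
  · rw [Bool.and_eq_true, decide_eq_true_eq] at hmove
    obtain ⟨hS, hall⟩ := hmove
    refine inScopeStateWins_move row.2.1 ((isPermissibleCentre_iff q row.2.1 row.1.L).mpr hS) ?_
    rintro s' ⟨j, b, hj, hbj, heq, hne, rfl⟩
    have h := hall j hj b hbj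
    unfold ireplyOK at h
    rw [Bool.or_eq_true, Bool.or_eq_true] at h
    rcases h with (h1 | h2) | h3
    · rw [Bool.not_eq_true', ← Bool.not_eq_true] at h1
      exact absurd ((isEquimultiplePoint_iff q row.2.1 j b row.1).mp heq) h1
    · exact absurd h2
        (by rw [Bool.not_eq_true]; exact (step_F_ne_zero_iff q row.2.1 j b row.1).mp hne)
    · obtain ⟨r, hr, hrc⟩ := exists_of_ichildIn h3
      rw [step_toState, hrc]
      exact hrest r hr

/-- **SOUNDNESS OF IN-SCOPE WIN CERTIFICATES**: every state of a checked certificate is in A's attractor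
of the F4-C game over the finite field `K`. [folklore] -/
theorem inScopeStateWins_of_iwinCertB {q : ℕ} :
    ∀ {T : ICert K}, iwinCertB q T = true → ∀ row ∈ T, InScopeStateWins q row.1.toState
  | [], _ => fun row hrow => absurd hrow List.not_mem_nil
  | row :: rest, h => by
    unfold iwinCertB at h
    rw [Bool.and_eq_true] at h
    have hrest := inScopeStateWins_of_iwinCertB h.2
    intro r hr
    rcases List.mem_cons.mp hr with rfl | hr'
    · exact inScopeStateWins_of_irowOK hrest h.1
    · exact hrest r hr'

/-- The ROOT of a checked certificate is in-scope escapable. [folklore] -/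
theorem inScopeStateWins_head_of_iwinCertB {q : ℕ} {row : IRow K} {rest : ICert K}
    (h : iwinCertB q (row :: rest) = true) : InScopeStateWins q row.1.toState :=
  inScopeStateWins_of_iwinCertB h row List.mem_cons_self

/-! ## 4. Full-game certificates are in-scope certificates -/

/-- Forgetful embedding of a full-game row. [folklore] -/
def ofWRow (r : WRow K) : IRow K := (r.1, r.2, none)

omit [DecidableEq K] [Fintype K] in
/-- `ichildIn` on an embedded certificate is `childIn`. [folklore] -/
theorem ichildIn_map [DecidableEq K] [Fintype K] (rest : WCert K) (c : SData 4 K) :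
    ichildIn (rest.map ofWRow) c = childIn rest c := by
  unfold ichildIn childIn
  rw [List.any_map]
  rfl

/-- **A checked full-game certificate embeds as a checked in-scope certificate.** [folklore] -/
theorem iwinCertB_map_of_winCertB {q : ℕ} :
    ∀ {T : WCert K}, winCertB q T = true → iwinCertB q (T.map ofWRow) = true
  | [], _ => rfl
  | row :: rest, h => by
    unfold winCertB at h
    rw [Bool.and_eq_true] at h
    rw [List.map_cons]
    unfold iwinCertB
    rw [Bool.and_eq_true]
    refine ⟨?_, iwinCertB_map_of_winCertB h.2⟩
    have h1 := h.1
    unfold rowOK at h1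
    unfold irowOK
    rw [Bool.or_eq_true, Bool.or_eq_true]
    rw [Bool.or_eq_true] at h1
    rcases h1 with ht | hm
    · exact Or.inl (Or.inr ht)
    · refine Or.inr ?_
      rw [Bool.and_eq_true, decide_eq_true_eq] at hm ⊢
      refine ⟨hm.1, fun j hj b hb => ?_⟩
      have := hm.2 j hj b hb
      unfold replyOK at this
      unfold ireplyOK
      change (!equiB q row.2 j b row.1 || StepKit.equivB (stepD q row.2 j b row.1).L [] ||
          ichildIn (rest.map ofWRow) (stepD q row.2 j b row.1)) = true
      rwa [ichildIn_map]

/-! ## 5. Acceptance over `𝔽₂`: the SCOPE-LOSS parent is in-scope escapable in one move -/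

/-- res-dim4-p-6's SCOPE-LOSS parent `F = x₁³x₂ + x₁³x₃x₄` (`r = 0`, `exc = ∅`), A's centre the forced
divisor `{x₁}`; then the four EQUIMULTIPLE `𝔽₂`-replies `b = (0, b₂, b₃, b₄)` with `b₂ = b₃b₄`, children
`x₁(x₂ + b₄x₃ + b₃x₄ + x₃x₄)` (`r = (1,0,0,0)`, `exc = {x₁}`), each with a monomial-curve BLINDNESS
certificate (curves `(0,t²,t,t)`, `(0,t,0,t)`, `(0,t,t,0)`, `(0,t,t,0)`; witness `∂₁F′(0,1,0,0) = 1`).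
[folklore] -/
def scopeLossCert : ICert (ZMod 2) :=
  [(⟨[(![3, 1, 0, 0], 1), (![3, 0, 1, 1], 1)], ![0, 0, 0, 0], ∅⟩, {0}, none),
   (⟨[(![1, 1, 0, 0], 1), (![1, 0, 1, 1], 1)], ![1, 0, 0, 0], {0}⟩, ∅,
      some (.mono ![0, 1, 1, 1] ![0, 2, 1, 1] ![1, 0, 0, 0] ![0, 1, 0, 0])),
   (⟨[(![1, 1, 0, 0], 1), (![1, 0, 0, 1], 1), (![1, 0, 1, 1], 1)], ![1, 0, 0, 0], {0}⟩, ∅,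
      some (.mono ![0, 1, 0, 1] ![0, 1, 0, 1] ![1, 0, 0, 0] ![0, 1, 0, 0])),
   (⟨[(![1, 1, 0, 0], 1), (![1, 0, 1, 0], 1), (![1, 0, 1, 1], 1)], ![1, 0, 0, 0], {0}⟩, ∅,
      some (.mono ![0, 1, 1, 0] ![0, 1, 1, 0] ![1, 0, 0, 0] ![0, 1, 0, 0])),
   (⟨[(![1, 1, 0, 0], 1), (![1, 0, 1, 0], 1), (![1, 0, 0, 1], 1), (![1, 0, 1, 1], 1)], ![1, 0, 0, 0],
      {0}⟩, ∅, some (.mono ![0, 1, 1, 0] ![0, 1, 1, 0] ![1, 0, 0, 0] ![0, 1, 0, 0]))]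

/-- The SCOPE-LOSS certificate checks (`q = 2`, over `𝔽₂`). [folklore] -/
theorem iwinCertB_scopeLoss : iwinCertB 2 scopeLossCert = true := by
  decide

/-- **The SCOPE-LOSS parent `x₁³x₂ + x₁³x₃x₄` is IN-SCOPE ESCAPABLE over `𝔽₂`** (one move: the forced
divisor; every equimultiple `𝔽₂`-reply is blind). [folklore] -/
theorem inScopeStateWins_scopeLoss :
    InScopeStateWins 2
      (⟨[(![3, 1, 0, 0], 1), (![3, 0, 1, 1], 1)], ![0, 0, 0, 0], ∅⟩ : SData 4 (ZMod 2)).toState :=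
  inScopeStateWins_head_of_iwinCertB iwinCertB_scopeLoss

end InScopeWinCert

end Summit.ResolutionOfSingularities.ResolutionOfSingularities.Theorems.PIDim4

end
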